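import Summits.Ventures.CertifiedManyBodySolver.Observables.RungLeavesCoverageNdNiO2Residual
import Summits.Ventures.CertifiedManyBodySolver.Certificates.HubbardSquare_NdM21CutBoxE_stiffness_kinematic
import HarnessLib

/-!
# Ventures/CertifiedManyBodySolver — Observables/RungLeavesCoverageNdNiO2ResidualAffine.lean

HONEST FRAMING: one-sided certified CEILINGS on the uniform flux stiffness on the DOWNFOLDED d⁹-nickelate box of record `boxNdNiO2E_M21`
(NdNiO₂ parent film) — wording class (xx1): CONTROL / CALIBRATION + labelled heuristic; a ceiling never speaks to the presence of superconductivity;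
a downfolded box is a systematic modelling claim (router/BOXES/NdNiO2.md «1BH+3BE»); never «certified true negative / positive»; not a `T_c` or
phase-diagram statement; no summit statement is proved here. Prop-level SHAPES and CLOSERS only, CONDITIONAL BY NAME on the certified rows, caps and
floors they name; no number of record is asserted; no `sorry`; no definition.

Cells `pub/hubbard-obs` ∧ `pub/hubbard-downfold` (MO-S2, D-0154 (1)(C) COVERAGE material (iii) NdNiO₂), seat `hubbard-cov-ndnio2-box-1`
(`prover-hubbard-cov-ndnio2-box-1-0`; lane «claim-node SHAPES + one-`exact` closers», obs RULING (nnn) d310 (nnn7) / captain D1′). Sequel of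
`Observables/RungLeavesCoverageNdNiO2Residual{,Cut}.lean`. THE POINT. A station certificate is SOLVED at one density `n₀ = 477/500` with two FIXED
energy rows (`h₀ ≤ hi`, `−h₀ ≤ −lo`), but the residual box of the rung leaf «MOS2-ndnio2-M21» is a density INTERVAL `x ∈ [9/10, 477/500]`
(hubbard-cov-ndnio2-ref-1 flag f1′). unc-2's `Rows/DopedTLCorrFilling{,Cert}.lean` reads ONE window certificate at EVERY density in two kernel-grounded shapes:
the WINDOW-N row `SquareTTPrimeCorrOrbitLowerRowWN` (value `r + s·(x − n₀)` wherever the SAME window `[lo, hi]` holds at `x`) and the AFFINE-N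
(Lagrangian) row `SquareTTPrimeCorrAffineOrbitLowerRowN` (value `q + s·(x − n₀) + κhi·(hi − e₀(x)) + κlo·(e₀(x) − lo)`, NO window hypothesis at `x`).
This file turns both into the unconditional orbit-lower FAMILIES the station engines consume:

* §1 `orbitLower_of_rowWN_of_window` — WN row + a window `lo ≤ e₀(1, s, U_A, x) ≤ hi` certified AT `x` ⇒ value `r + s·(x − n₀)`;
  `orbitLower_of_affineRowN_of_cap_of_floor` — affine-N row + ANY certified cap `e₀(1, s, U_A, x) ≤ u` and floor `fl ≤ e₀(1, s, U_A, x)` at `x`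
  (`κhi, κlo ≥ 0`) ⇒ value `q + s·(x − n₀) + κhi·(hi − u) + κlo·(fl − lo)`. So a certificate keyed with the cap `C1 = (477/500)·K`
  (`Certificates/HubbardSquare_NdBoxE_station5_apriori_caps.lean`) read at `x < 477/500` with the a-priori cap `u = x·K > C1` is not void — it PAYS
  `κhi·(x·K − C1)` (≤ `κhi × 0.0361650` on `[9/10, 477/500]`); a tighter certified cap (W1) pays less.
* §2 the RESIDUAL CLOSER in the affine-N shape at the cover of record (`t_s = −11/25`, `n_s = 9/10`):
  `stiffnessBoxCeilingBelow_boxNdNiO2E_M21_of_residualStation5AffineRows_cut11o25_n9o10` — per source `s ∈ [−276/425, −11/25]` of the station `U_A = 5`,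
  affine-N rows for the two END objectives `−X₀(−23/50, 5)` / `−X₀(−11/25, 5)` (tables `qP qT κhiP κhiT κloP κloT slP slT : ℝ → ℚ`, anchor `477/500`, window
  rows `lo hi : ℝ → ℚ`), a cap table `u` and a floor table `fl` on `[9/10, 477/500] × segment`, the σ-chord price of the resulting family values `≤ c ≤ bar`, plus
  the kinematic cover pieces by name ⇒ `StiffnessBoxCeilingBelow boxNdNiO2E_M21 bar`; leaf instance at `4779578/10⁷`. The `s`-continuum (flag f2′) stays an
  explicit hypothesis (interval-valid / bundle certificates only).

References: S. Boyd, L. Vandenberghe, *Convex Optimization* (2004) §5.6 [BoydVandenberghe2004]; J. Wang et al., PRX 14 (2024) 031006, §III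
[WangEtAl2024]; T. Koma, H. Tasaki, J. Stat. Phys. 76 (1994) 745, §1 [KomaTasaki1994]; D. J. Scalapino, S. R. White, S.-C. Zhang, PRB 47 (1993) 7995, §II
[ScalapinoWhiteZhang1993].
-/

noncomputable section

namespace Summit.Ventures.CertifiedManyBodySolver.Observables

open Set NonemptyInterval Filter Topology
open Summit.Ventures.CertifiedManyBodySolver.Downfold
open Summit.Ventures.CertifiedManyBodySolver.Certificates
open Literature.MathematicalPhysics.QuantumLattice Literature.MathematicalPhysics.QuantumLattice.ThermodynamicLimit
open Literature.Probability.LatticeModels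
open Matrix HubbardWave0
open scoped BigOperators ComplexOrder

/-! ## §1 Density-parametrised rows ⇒ the engines' families -/

section Shapes

variable {s UA x σ : ℝ}

/-- **WINDOW-N row + the window at `x` ⇒ family value `r + sl·(x − n₀)`.** [cite: WangEtAl2024, §III] -/
theorem orbitLower_of_rowWN_of_window {lo hi r sl n₀ : ℚ}
    (hrow : SquareTTPrimeCorrOrbitLowerRowWN s UA lo hi r sl n₀ Finset.univ (Literature.Probability.LatticeModels.box 2 7)
      (-oddMomentObsTT σ UA 0))
    (hx0 : 0 ≤ x) (hx2 : x < 2) (hlo : ((lo : ℚ) : ℝ) ≤ energyDensityTT' 1 s UA x) (hhi : energyDensityTT' 1 s UA x ≤ ((hi : ℚ) : ℝ)) :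
    ∀ (ω : InfVolFermionState 2) (Ls : ℕ → ℕ) (ψ : ∀ L, Fock (Orb (FermionTorus 2 L))),
      Tendsto Ls atTop atTop →
      (∀ j, IsGroundStateInSector (hubbardTorusTT' (Ls j) 1 s UA) (rectN x (Ls j)) 0 (ψ (Ls j))) →
      (∀ j, star (ψ (Ls j)) ⬝ᵥ ψ (Ls j) = 1) → ω.IsTorusLimitOf ψ Ls →
      ((r : ℚ) : ℝ) + ((sl : ℚ) : ℝ) * (x - ((n₀ : ℚ) : ℝ)) ≤
        ((Finset.univ : Finset (DihedralGroup 4)).card : ℝ)⁻¹ * ∑ g ∈ (Finset.univ : Finset (DihedralGroup 4)),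
          (ω.expect (d4ShiftSet g 0 (Literature.Probability.LatticeModels.box 2 7))
            (fermionEmbed (PolySite.d4Emb g 0 (Literature.Probability.LatticeModels.box 2 7)) (-oddMomentObsTT σ UA 0))).re :=
  fun ω Ls ψ hLs hψ h1 hω => hrow x hx0 hx2 ω Ls ψ hLs hψ h1 hω hlo hhi

/-- **AFFINE-N (Lagrangian) row + ANY cap and floor at `x` ⇒ family value `q + sl·(x − n₀) + κhi·(hi − u) + κlo·(fl − lo)`** (`κhi, κlo ≥ 0`): the
window validity at `x` is NOT required; a weaker cap `u > hi` / floor `fl < lo` is paid for linearly. [cite: BoydVandenberghe2004, §5.6] [cite: WangEtAl2024, §III] -/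
theorem orbitLower_of_affineRowN_of_cap_of_floor {q hi lo κhi κlo sl n₀ : ℚ} (hκhi : 0 ≤ κhi) (hκlo : 0 ≤ κlo)
    (hrow : SquareTTPrimeCorrAffineOrbitLowerRowN s UA q hi lo κhi κlo sl n₀ Finset.univ (Literature.Probability.LatticeModels.box 2 7)
      (-oddMomentObsTT σ UA 0))
    (hx0 : 0 ≤ x) (hx2 : x < 2) {u fl : ℝ} (hcap : energyDensityTT' 1 s UA x ≤ u) (hfloor : fl ≤ energyDensityTT' 1 s UA x) :
    ∀ (ω : InfVolFermionState 2) (Ls : ℕ → ℕ) (ψ : ∀ L, Fock (Orb (FermionTorus 2 L))),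
      Tendsto Ls atTop atTop →
      (∀ j, IsGroundStateInSector (hubbardTorusTT' (Ls j) 1 s UA) (rectN x (Ls j)) 0 (ψ (Ls j))) →
      (∀ j, star (ψ (Ls j)) ⬝ᵥ ψ (Ls j) = 1) → ω.IsTorusLimitOf ψ Ls →
      ((q : ℚ) : ℝ) + ((sl : ℚ) : ℝ) * (x - ((n₀ : ℚ) : ℝ)) + ((κhi : ℚ) : ℝ) * (((hi : ℚ) : ℝ) - u) +
          ((κlo : ℚ) : ℝ) * (fl - ((lo : ℚ) : ℝ)) ≤
        ((Finset.univ : Finset (DihedralGroup 4)).card : ℝ)⁻¹ * ∑ g ∈ (Finset.univ : Finset (DihedralGroup 4)),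
          (ω.expect (d4ShiftSet g 0 (Literature.Probability.LatticeModels.box 2 7))
            (fermionEmbed (PolySite.d4Emb g 0 (Literature.Probability.LatticeModels.box 2 7)) (-oddMomentObsTT σ UA 0))).re := by
  intro ω Ls ψ hLs hψ h1 hω
  have h := hrow x hx0 hx2 ω Ls ψ hLs hψ h1 hω
  have hκhi' : (0 : ℝ) ≤ ((κhi : ℚ) : ℝ) := by exact_mod_cast hκhi
  have hκlo' : (0 : ℝ) ≤ ((κlo : ℚ) : ℝ) := by exact_mod_cast hκlo
  have h₁ : ((κhi : ℚ) : ℝ) * (((hi : ℚ) : ℝ) - u) ≤ ((κhi : ℚ) : ℝ) * (((hi : ℚ) : ℝ) - energyDensityTT' 1 s UA x) :=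
    mul_le_mul_of_nonneg_left (by linarith) hκhi'
  have h₂ : ((κlo : ℚ) : ℝ) * (fl - ((lo : ℚ) : ℝ)) ≤ ((κlo : ℚ) : ℝ) * (energyDensityTT' 1 s UA x - ((lo : ℚ) : ℝ)) :=
    mul_le_mul_of_nonneg_left (by linarith) hκlo'
  linarith

end Shapes

/-! ## §2 The residual closer in the affine-N shape at the cover of record (`t_s = −11/25`, `n_s = 9/10`) -/

/-- The affine-N family value at `(x, s)` from the tables: `q + sl·(x − 477/500) + κhi·(hi − u) + κlo·(fl − lo)`. (A local abbreviation used only in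
statements below; all arguments explicit.) [cite: BoydVandenberghe2004, §5.6] -/
theorem affineRowN_value_eq (q sl κhi κlo hi lo : ℚ) (u fl x : ℝ) :
    ((q : ℚ) : ℝ) + ((sl : ℚ) : ℝ) * (x - (((477 / 500 : ℚ)) : ℝ)) + ((κhi : ℚ) : ℝ) * (((hi : ℚ) : ℝ) - u) +
        ((κlo : ℚ) : ℝ) * (fl - ((lo : ℚ) : ℝ)) =
      ((q : ℚ) : ℝ) + ((sl : ℚ) : ℝ) * (x - 477 / 500) + ((κhi : ℚ) : ℝ) * (((hi : ℚ) : ℝ) - u) +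
        ((κlo : ℚ) : ℝ) * (fl - ((lo : ℚ) : ℝ)) := by
  push_cast; ring

/-- **THE RESIDUAL CLOSER, AFFINE-N SHAPE (bar-parametric).** Station `U_A = 5`; for every source `s` of the segment `[−276/425, −11/25]`: two AFFINE-N rows
(anchor density `477/500`, window rows `lo s`, `hi s`) — `qP s, κhiP s, κloP s, slP s` on the corner objective `−X₀(−23/50, 5)` and `qT s, κhiT s, κloT s, slT s` on the
split-slot objective `−X₀(−11/25, 5)` (`SquareTTPrimeCorrAffineOrbitLowerRowN`, interval-valid in `s`: bundle / box-row certificates); a certified CAP table `u x s` and FLOOR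
table `fl x s` on `[9/10, 477/500] × [−276/425, −11/25]`; the negated σ-chord of the two affine values `vP x s`, `vT x s` is `≤ c` on `σ ∈ [−23/50, −11/25]`, `s ∈ [24σ/17, σ]`;
`c ≤ bar`, `0.4768946 ≤ bar` ⇒ `StiffnessBoxCeilingBelow boxNdNiO2E_M21 bar` (cover pieces `ndM21CutBoxE_stiffnessSeqLeaf`, `ndBoxE_parent_stiffnessSeqLeaf` by name).
[cite: KomaTasaki1994, §1] [cite: ScalapinoWhiteZhang1993, §II] [cite: BoydVandenberghe2004, §5.6] -/
theorem stiffnessBoxCeilingBelow_boxNdNiO2E_M21_of_residualStation5AffineRows_cut11o25_n9o10 {bar c : ℚ} (hbar : 4768946 / 10000000 ≤ bar)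
    (qP κhiP κloP slP qT κhiT κloT slT lo hi : ℝ → ℚ) (u fl : ℝ → ℝ → ℝ)
    (hκhiP : ∀ s ∈ Set.Icc (-(276 / 425) : ℝ) (-11 / 25), 0 ≤ κhiP s) (hκloP : ∀ s ∈ Set.Icc (-(276 / 425) : ℝ) (-11 / 25), 0 ≤ κloP s)
    (hκhiT : ∀ s ∈ Set.Icc (-(276 / 425) : ℝ) (-11 / 25), 0 ≤ κhiT s) (hκloT : ∀ s ∈ Set.Icc (-(276 / 425) : ℝ) (-11 / 25), 0 ≤ κloT s)
    (hrowP : ∀ s ∈ Set.Icc (-(276 / 425) : ℝ) (-11 / 25),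
      SquareTTPrimeCorrAffineOrbitLowerRowN s 5 (qP s) (hi s) (lo s) (κhiP s) (κloP s) (slP s) (477 / 500) Finset.univ
        (Literature.Probability.LatticeModels.box 2 7) (-oddMomentObsTT (-23 / 50) 5 0))
    (hrowT : ∀ s ∈ Set.Icc (-(276 / 425) : ℝ) (-11 / 25),
      SquareTTPrimeCorrAffineOrbitLowerRowN s 5 (qT s) (hi s) (lo s) (κhiT s) (κloT s) (slT s) (477 / 500) Finset.univ
        (Literature.Probability.LatticeModels.box 2 7) (-oddMomentObsTT (-11 / 25) 5 0))
    (hcap : ∀ x ∈ Set.Icc (9 / 10 : ℝ) (477 / 500), ∀ s ∈ Set.Icc (-(276 / 425) : ℝ) (-11 / 25), energyDensityTT' 1 s 5 x ≤ u x s)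
    (hfloor : ∀ x ∈ Set.Icc (9 / 10 : ℝ) (477 / 500), ∀ s ∈ Set.Icc (-(276 / 425) : ℝ) (-11 / 25), fl x s ≤ energyDensityTT' 1 s 5 x)
    (hprice : ∀ x ∈ Set.Icc (9 / 10 : ℝ) (477 / 500), ∀ σ ∈ Set.Icc (-23 / 50 : ℝ) (-11 / 25), ∀ s ∈ Set.Icc (σ * (24 / 17)) σ,
      -((-11 / 25 - σ) / (-11 / 25 - -23 / 50) *
            (((qP s : ℚ) : ℝ) + ((slP s : ℚ) : ℝ) * (x - 477 / 500) + ((κhiP s : ℚ) : ℝ) * (((hi s : ℚ) : ℝ) - u x s) +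
              ((κloP s : ℚ) : ℝ) * (fl x s - ((lo s : ℚ) : ℝ))) +
          (σ - -23 / 50) / (-11 / 25 - -23 / 50) *
            (((qT s : ℚ) : ℝ) + ((slT s : ℚ) : ℝ) * (x - 477 / 500) + ((κhiT s : ℚ) : ℝ) * (((hi s : ℚ) : ℝ) - u x s) +
              ((κloT s : ℚ) : ℝ) * (fl x s - ((lo s : ℚ) : ℝ)))) ≤ ((c : ℚ) : ℝ))
    (hc : c ≤ bar) :
    StiffnessBoxCeilingBelow boxNdNiO2E_M21 bar := by
  obtain ⟨e, eP, -⟩ := ndnio2_M21_station5_geometry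
  refine stiffnessBoxCeilingBelow_boxNdNiO2E_M21_of_residualCover (ts := -11 / 25) (ns := 9 / 10) (cT := 4768946 / 10000000)
    (cN := 4736879 / 10000000) hc hbar (le_trans (by norm_num) hbar) (fun tp htp U hU n hn => ?_)
    (fun _ htp _ _ _ hn => ndM21CutBoxE_stiffnessSeqLeaf htp (by linarith [hn.1]) hn.2)
    (fun _ htp _ _ _ hn => ndBoxE_parent_stiffnessSeqLeaf ⟨htp.1, by linarith [htp.2]⟩ (by linarith [hn.1]) hn.2)
  -- the residual box from the station `U_A = 5` with the two affine-N families
  refine ObsStiffnessSeqCeilingAt_on_box3_of_apexStation_twoEndObjectives (p := -23 / 50) (q := -11 / 25) (UA := 5) (Umax := 17 / 2)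
    (n₁ := 9 / 10) (n₂ := 477 / 500) (by norm_num) (by norm_num) (by norm_num) (by norm_num) (by norm_num)
    (fun x s => ((qP s : ℚ) : ℝ) + ((slP s : ℚ) : ℝ) * (x - 477 / 500) + ((κhiP s : ℚ) : ℝ) * (((hi s : ℚ) : ℝ) - u x s) +
      ((κloP s : ℚ) : ℝ) * (fl x s - ((lo s : ℚ) : ℝ)))
    (fun x s => ((qT s : ℚ) : ℝ) + ((slT s : ℚ) : ℝ) * (x - 477 / 500) + ((κhiT s : ℚ) : ℝ) * (((hi s : ℚ) : ℝ) - u x s) +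
      ((κloT s : ℚ) : ℝ) * (fl x s - ((lo s : ℚ) : ℝ)))
    c (fun x hx s hs => ?_) (fun x hx s hs => ?_) (fun x hx σ hσ s hs => hprice x hx σ hσ s (by rwa [e] at hs)) tp htp U hU n hn
  · rw [e, eP] at hs
    have h := orbitLower_of_affineRowN_of_cap_of_floor (σ := -23 / 50) (hκhiP s hs) (hκloP s hs) (hrowP s hs)
      (by linarith [hx.1]) (by linarith [hx.2]) (hcap x hx s hs) (hfloor x hx s hs)
    rw [affineRowN_value_eq] at h
    exact h
  · rw [e, eP] at hs
    have h := orbitLower_of_affineRowN_of_cap_of_floor (σ := -11 / 25) (hκhiT s hs) (hκloT s hs) (hrowT s hs)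
      (by linarith [hx.1]) (by linarith [hx.2]) (hcap x hx s hs) (hfloor x hx s hs)
    rw [affineRowN_value_eq] at h
    exact h

/-- **The rung leaf from the affine-N station rows** (`c ≤ 0.4779578`). [cite: KomaTasaki1994, §1] [cite: ScalapinoWhiteZhang1993, §II] -/
theorem NdNiO2M21_StiffnessBoxCeiling_of_residualStation5AffineRows_cut11o25_n9o10 {c : ℚ}
    (qP κhiP κloP slP qT κhiT κloT slT lo hi : ℝ → ℚ) (u fl : ℝ → ℝ → ℝ)
    (hκhiP : ∀ s ∈ Set.Icc (-(276 / 425) : ℝ) (-11 / 25), 0 ≤ κhiP s) (hκloP : ∀ s ∈ Set.Icc (-(276 / 425) : ℝ) (-11 / 25), 0 ≤ κloP s)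
    (hκhiT : ∀ s ∈ Set.Icc (-(276 / 425) : ℝ) (-11 / 25), 0 ≤ κhiT s) (hκloT : ∀ s ∈ Set.Icc (-(276 / 425) : ℝ) (-11 / 25), 0 ≤ κloT s)
    (hrowP : ∀ s ∈ Set.Icc (-(276 / 425) : ℝ) (-11 / 25),
      SquareTTPrimeCorrAffineOrbitLowerRowN s 5 (qP s) (hi s) (lo s) (κhiP s) (κloP s) (slP s) (477 / 500) Finset.univ
        (Literature.Probability.LatticeModels.box 2 7) (-oddMomentObsTT (-23 / 50) 5 0))
    (hrowT : ∀ s ∈ Set.Icc (-(276 / 425) : ℝ) (-11 / 25),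
      SquareTTPrimeCorrAffineOrbitLowerRowN s 5 (qT s) (hi s) (lo s) (κhiT s) (κloT s) (slT s) (477 / 500) Finset.univ
        (Literature.Probability.LatticeModels.box 2 7) (-oddMomentObsTT (-11 / 25) 5 0))
    (hcap : ∀ x ∈ Set.Icc (9 / 10 : ℝ) (477 / 500), ∀ s ∈ Set.Icc (-(276 / 425) : ℝ) (-11 / 25), energyDensityTT' 1 s 5 x ≤ u x s)
    (hfloor : ∀ x ∈ Set.Icc (9 / 10 : ℝ) (477 / 500), ∀ s ∈ Set.Icc (-(276 / 425) : ℝ) (-11 / 25), fl x s ≤ energyDensityTT' 1 s 5 x)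
    (hprice : ∀ x ∈ Set.Icc (9 / 10 : ℝ) (477 / 500), ∀ σ ∈ Set.Icc (-23 / 50 : ℝ) (-11 / 25), ∀ s ∈ Set.Icc (σ * (24 / 17)) σ,
      -((-11 / 25 - σ) / (-11 / 25 - -23 / 50) *
            (((qP s : ℚ) : ℝ) + ((slP s : ℚ) : ℝ) * (x - 477 / 500) + ((κhiP s : ℚ) : ℝ) * (((hi s : ℚ) : ℝ) - u x s) +
              ((κloP s : ℚ) : ℝ) * (fl x s - ((lo s : ℚ) : ℝ))) +
          (σ - -23 / 50) / (-11 / 25 - -23 / 50) *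
            (((qT s : ℚ) : ℝ) + ((slT s : ℚ) : ℝ) * (x - 477 / 500) + ((κhiT s : ℚ) : ℝ) * (((hi s : ℚ) : ℝ) - u x s) +
              ((κloT s : ℚ) : ℝ) * (fl x s - ((lo s : ℚ) : ℝ)))) ≤ ((c : ℚ) : ℝ))
    (hc : c ≤ 4779578 / 10000000) :
    NdNiO2M21_StiffnessBoxCeiling :=
  stiffnessBoxCeilingBelow_boxNdNiO2E_M21_of_residualStation5AffineRows_cut11o25_n9o10 (by norm_num) qP κhiP κloP slP qT κhiT κloT slT lo hi
    u fl hκhiP hκloP hκhiT hκloT hrowP hrowT hcap hfloor hprice hc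

end Summit.Ventures.CertifiedManyBodySolver.Observables

end
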